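import Mathlib.Data.Nat.Digits.Lemmas
import Mathlib.Data.List.Infix
import Mathlib.Data.Complex.Basic
import Mathlib.Data.Fintype.Pi
import Literature.NumberTheory.LFunctions.MultiplicativeAutomatic
import HarnessLib

/-!
# Automatic sequences: finite automata read from the most significant digit, synchronizing words, and the kernel characterisation (proved)

Everything in this file is PROVED (plus three plain definitions). It supplies the automaton side
of the vocabulary of C. Müllner, *Automatic sequences fulfill the Sarnak conjecture* (Duke Math.
J. 166 (2017)), §1.1, over which the printed proof of
`Literature.NumberTheory.LFunctions.mullner_moebius_automatic` runs, and links it to the tree's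
kernel definition `Literature.NumberTheory.LFunctions.IsAutomaticSeq`
(`MultiplicativeAutomatic.lean`, finite `k`-kernel):

* `msbBlock k L r` — Müllner's `(r)_k^L`, the base-`k` expansion of `r < k^L` read from the most
  significant digit and padded to length `L`; concatenation `msbBlock_add`, and the digits of
  `r + k^L m` (`digits_add_pow_mul`).
* `dfaoSeq k δ q₀ τ` — the sequence `a_n = τ(δ(q₀, (n)_k))` generated by a DFAO
  `(σ, δ, q₀, τ)` reading digits from the most significant one (Müllner Def. 1.6; unbundled:
  `δ : σ → ℕ → σ` is only ever fed digits `< k`); reading `r + k^L m` = reading `m` then the block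
  of `r` (`foldl_digits_add_pow_mul`); a synchronizing word `w` (`δ(q, w) = q_w` for all `q`)
  makes the state after any word containing `w` independent of the start (`foldl_eq_of_infix`,
  `dfaoSeq_eq_of_infix`).
* `syncBad k L w` — the residues `r < k^L` whose block avoids `w` (complement of Müllner's
  `M_{λ}`), with the count `#syncBad(|w| t) ≤ (k^{|w|} − 1)^t` (`card_syncBad_mul_le`).
* **Allouche–Shallit Thm. 6.6.2** in the tree's vocabulary (`isAutomaticSeq_iff_exists_dfaoSeq`):
  for `k ≥ 2`, finite `k`-kernel ⇔ generated by a DFAO with finitely many states (MSB-first);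
  "⇒" builds the automaton of self-maps of `{a} ∪ K_k(a)` (kernel maps `g ↦ g(k· + d)` composed
  on the right, i.e. the reversal of the kernel automaton), "⇐" parametrises the kernel element
  `(a(k^i n + r))_n` by the state map `q ↦ δ(q, (r)_k^i)` and the value `a(r)`.

## References
* C. Müllner, Duke Math. J. 166 (2017) 3219–3290, §1.1 (Defs. 1.4–1.7), §3.1. [Mullner2017]
* J.-P. Allouche, J. Shallit, *Automatic Sequences*, CUP 2003, Thm. 6.6.2 (`k`-kernel
  characterisation), Thm. 4.3.3 / §5.2 (reading direction). [AlloucheShallit2003]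
-/

noncomputable section

open Finset

namespace Literature.NumberTheory.LFunctions

/-! ## Fixed-length most-significant-digit-first blocks -/

/-- The base-`k` expansion of `r` read from the MOST significant digit, padded with leading zeros
to length `L` (Müllner's `(r)_k^L`, for `r < k^L`). [cite: Mullner2017, §1.1] -/
def msbBlock (k L r : ℕ) : List ℕ :=
  (Nat.digitsAppend k L r).reverse

/-- `msbBlock k L r` has length `L` when `r < k^L`. [folklore] -/
theorem length_msbBlock {k L r : ℕ} (hk : 1 < k) (hr : r < k ^ L) : (msbBlock k L r).length = L := by
  rw [msbBlock, List.length_reverse, Nat.length_digitsAppend hk L hr]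

/-- The letters of `msbBlock k L r` are digits `< k`. [folklore] -/
theorem lt_of_mem_msbBlock {k L r d : ℕ} (hk : 1 < k) (hd : d ∈ msbBlock k L r) : d < k := by
  rw [msbBlock, List.mem_reverse] at hd
  exact Nat.lt_of_mem_digitsAppend hk L d hd

/-- Reading `msbBlock k L r` back (least significant digit first) gives `r`. [folklore] -/
theorem ofDigits_reverse_msbBlock (k L r : ℕ) : Nat.ofDigits k (msbBlock k L r).reverse = r := by
  rw [msbBlock, List.reverse_reverse, Nat.digitsAppend, Nat.ofDigits_append_replicate_zero,
    Nat.ofDigits_digits]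

/-- A word of length `L` over `{0,…,k-1}` is the block of the number it denotes. [folklore] -/
theorem msbBlock_ofDigits_reverse {k : ℕ} (hk : 1 < k) {w : List ℕ} (hw : ∀ d ∈ w, d < k) :
    msbBlock k w.length (Nat.ofDigits k w.reverse) = w := by
  apply List.reverse_injective
  rw [msbBlock, List.reverse_reverse]
  have h := (Nat.setInvOn_digitsAppend_ofDigits hk w.length).1
    (⟨List.length_reverse, fun d hd => hw d (List.mem_reverse.1 hd)⟩ :
      w.reverse ∈ {L : List ℕ | L.length = w.length ∧ ∀ x ∈ L, x < k})
  exact h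

/-- **Concatenation of blocks**: the block of length `L + ℓ` of `k^ℓ m + c` (`m < k^L`, `c < k^ℓ`)
is the block of `m` followed by the block of `c`. [folklore] -/
theorem msbBlock_add {k L ℓ m c : ℕ} (hk : 1 < k) (hm : m < k ^ L) (hc : c < k ^ ℓ) :
    msbBlock k (L + ℓ) (k ^ ℓ * m + c) = msbBlock k L m ++ msbBlock k ℓ c := by
  apply List.reverse_injective
  rw [List.reverse_append]
  have hlt : k ^ ℓ * m + c < k ^ (L + ℓ) := by
    calc k ^ ℓ * m + c < k ^ ℓ * m + k ^ ℓ := by omega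
      _ = k ^ ℓ * (m + 1) := by ring
      _ ≤ k ^ ℓ * k ^ L := Nat.mul_le_mul_left _ hm
      _ = k ^ (L + ℓ) := by rw [pow_add, mul_comm]
  refine Nat.injOn_ofDigits hk (L + ℓ) ⟨?_, ?_⟩ ⟨?_, ?_⟩ ?_
  · rw [msbBlock, List.reverse_reverse, Nat.length_digitsAppend hk _ hlt]
  · intro d hd
    exact lt_of_mem_msbBlock hk (List.mem_reverse.1 hd)
  · rw [List.length_append, msbBlock, msbBlock, List.reverse_reverse, List.reverse_reverse,
      Nat.length_digitsAppend hk _ hc, Nat.length_digitsAppend hk _ hm, add_comm]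
  · intro d hd
    rcases List.mem_append.1 hd with h | h
    · exact lt_of_mem_msbBlock hk (List.mem_reverse.1 h)
    · exact lt_of_mem_msbBlock hk (List.mem_reverse.1 h)
  · rw [Nat.ofDigits_append, ofDigits_reverse_msbBlock, ofDigits_reverse_msbBlock,
      ofDigits_reverse_msbBlock, msbBlock, List.reverse_reverse, Nat.length_digitsAppend hk _ hc]
    ring

/-- **Digits of `r + k^L m`** (`r < k^L`, `m ≥ 1`): least significant first, they are the padded
digits of `r` followed by the digits of `m`. [folklore] -/
theorem digits_add_pow_mul {k L r m : ℕ} (hk : 1 < k) (hr : r < k ^ L) (hm : 0 < m) :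
    Nat.digits k (r + k ^ L * m) = Nat.digitsAppend k L r ++ Nat.digits k m := by
  have hlen : (Nat.digits k r).length ≤ L := (Nat.digits_length_le_iff hk r).2 hr
  have h := Nat.digits_append_zeroes_append_digits (k := L - (Nat.digits k r).length) (n := r) hk hm
  rw [Nat.add_sub_cancel' hlen] at h
  rw [Nat.digitsAppend]
  exact h.symm

/-! ## Automata read from the most significant digit -/

section DFAO

variable {σ : Type*}

/-- The sequence generated by a DFAO `(σ, δ, q₀, τ)` reading the base-`k` digits of `n` from the
most significant one: `a_n = τ(δ(q₀, (n)_k))`, with `(0)_k` the empty word (Müllner 2017,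
Def. 1.6; Allouche–Shallit, §5.1). [cite: Mullner2017, Def. 1.6] -/
def dfaoSeq (k : ℕ) (δ : σ → ℕ → σ) (q₀ : σ) (τ : σ → ℂ) (n : ℕ) : ℂ :=
  τ ((Nat.digits k n).reverse.foldl δ q₀)

/-- Reading `r + k^L m` (`r < k^L`, `m ≥ 1`): first the digits of `m`, then the length-`L` block of
`r`. [folklore] -/
theorem foldl_digits_add_pow_mul {k L r m : ℕ} (hk : 1 < k) (hr : r < k ^ L) (hm : 0 < m)
    (δ : σ → ℕ → σ) (q : σ) :
    (Nat.digits k (r + k ^ L * m)).reverse.foldl δ q =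
      (msbBlock k L r).foldl δ ((Nat.digits k m).reverse.foldl δ q) := by
  rw [digits_add_pow_mul hk hr hm, List.reverse_append, List.foldl_append, msbBlock]

/-- A synchronizing word resets the automaton: after reading any word containing `w`, the state
does not depend on the starting state. [cite: Mullner2017, §1.1 (synchronizing word)] -/
theorem foldl_eq_of_infix {δ : σ → ℕ → σ} {w l : List ℕ} {qw : σ} (hsync : ∀ q, w.foldl δ q = qw)
    (h : w <:+: l) (q q' : σ) : l.foldl δ q = l.foldl δ q' := by
  obtain ⟨u, v, rfl⟩ := h
  simp only [List.foldl_append, hsync]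

/-- **Key step** (Müllner §3.1, fixing the last digits): if the length-`L` block of `r < k^L`
contains the synchronizing word, then `a_{r + k^L m}` is the same for all `m ≥ 1`.
[cite: Mullner2017, §3.1] -/
theorem dfaoSeq_eq_of_infix {k L r : ℕ} (hk : 1 < k) (hr : r < k ^ L) {δ : σ → ℕ → σ} {q₀ : σ}
    {τ : σ → ℂ} {w : List ℕ} {qw : σ} (hsync : ∀ q, w.foldl δ q = qw)
    (hw : w <:+: msbBlock k L r) {m : ℕ} (hm : 0 < m) :
    dfaoSeq k δ q₀ τ (r + k ^ L * m) = dfaoSeq k δ q₀ τ (r + k ^ L * 1) := by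
  simp only [dfaoSeq, foldl_digits_add_pow_mul hk hr hm, foldl_digits_add_pow_mul hk hr one_pos]
  rw [foldl_eq_of_infix hsync hw]

end DFAO

/-! ## Counting the residues whose block avoids the synchronizing word -/

/-- The residues `r < k^L` whose length-`L` block does NOT contain `w` (the complement of
Müllner's `M_{λ₂}`, §3.1). [cite: Mullner2017, §3.1] -/
def syncBad (k L : ℕ) (w : List ℕ) : Finset ℕ :=
  (range (k ^ L)).filter fun r => ¬ w <:+: msbBlock k L r

/-- Membership in `syncBad`. [folklore] -/
theorem mem_syncBad {k L r : ℕ} {w : List ℕ} :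
    r ∈ syncBad k L w ↔ r < k ^ L ∧ ¬ w <:+: msbBlock k L r := by
  simp [syncBad]

/-- **One more block costs a factor `k^{|w|} − 1`**: appending a block of length `|w|` to a bad
residue keeps it bad only if the new block is not `w` itself, so
`#syncBad(L + |w|) ≤ (k^{|w|} − 1) · #syncBad(L)`. [cite: Mullner2017, §3.1] -/
theorem card_syncBad_add_le {k L : ℕ} (hk : 1 < k) {w : List ℕ} (hw : ∀ d ∈ w, d < k) :
    (syncBad k (L + w.length) w).card ≤ (syncBad k L w).card * (k ^ w.length - 1) := by
  set ℓ := w.length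
  set K := k ^ ℓ
  set ω := Nat.ofDigits k w.reverse
  have hKpos : 0 < K := pow_pos (by omega) ℓ
  have hωK : ω < K := by
    have := Nat.ofDigits_lt_base_pow_length hk (l := w.reverse)
      (fun d hd => hw d (List.mem_reverse.1 hd))
    rwa [List.length_reverse] at this
  have hωw : msbBlock k ℓ ω = w := msbBlock_ofDigits_reverse hk hw
  have hcard : ((syncBad k L w) ×ˢ ((range K).erase ω)).card = (syncBad k L w).card * (K - 1) := by
    rw [card_product, card_erase_of_mem (mem_range.2 hωK), card_range]
  rw [← hcard]
  refine card_le_card_of_injOn (fun r' => (r' / K, r' % K)) (fun r' hr' => ?_) ?_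
  · rw [mem_coe, mem_syncBad] at hr'
    obtain ⟨hr'lt, hbad⟩ := hr'
    have hdiv : r' / K < k ^ L := by
      rw [Nat.div_lt_iff_lt_mul hKpos, ← pow_add]; exact hr'lt
    have hmod : r' % K < K := Nat.mod_lt _ hKpos
    have hsplit : msbBlock k (L + ℓ) r' = msbBlock k L (r' / K) ++ msbBlock k ℓ (r' % K) := by
      conv_lhs => rw [← Nat.div_add_mod r' K]
      exact msbBlock_add hk hdiv hmod
    simp only [mem_coe, mem_product, mem_syncBad, mem_erase, mem_range]
    refine ⟨⟨hdiv, fun h => hbad ?_⟩, fun h => hbad ?_, hmod⟩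
    · rw [hsplit]
      exact h.trans (List.prefix_append _ _).isInfix
    · rw [hsplit, h, hωw]
      exact (List.suffix_append _ _).isInfix
  · intro r₁ _ r₂ _ h
    simp only [Prod.mk.injEq] at h
    rw [← Nat.div_add_mod r₁ K, ← Nat.div_add_mod r₂ K, h.1, h.2]

/-- At length `0` there is only the residue `0`. [folklore] -/
theorem card_syncBad_zero_le (k : ℕ) (w : List ℕ) : (syncBad k 0 w).card ≤ 1 := by
  calc (syncBad k 0 w).card ≤ (range (k ^ 0)).card := card_filter_le _ _
    _ = 1 := by simp

/-- **Exponentially few bad residues**: `#syncBad(|w| t) ≤ (k^{|w|} − 1)^t` — the count behind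
"`k^{λ₂} − |M_{λ₂}| ≤ c k^{(1−η)λ₂}`" in Müllner's proof of Prop. 3.3 (there quoted from
Deshouillers–Drmota–Müllner 2015). [cite: Mullner2017, §3.1] -/
theorem card_syncBad_mul_le {k : ℕ} (hk : 1 < k) {w : List ℕ} (hw : ∀ d ∈ w, d < k) (t : ℕ) :
    (syncBad k (w.length * t) w).card ≤ (k ^ w.length - 1) ^ t := by
  induction t with
  | zero => simpa using card_syncBad_zero_le k w
  | succ t ih =>
    rw [Nat.mul_succ, pow_succ]
    exact (card_syncBad_add_le hk hw).trans (Nat.mul_le_mul_right _ ih)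

/-! ## Finite kernel ⇔ finite automaton (Allouche–Shallit, Thm. 6.6.2), most-significant-digit-first model -/

section Bridge

variable {σ : Type*}

/-- The digits of `n` (least significant first) act on the kernel maps: folding
`g ↦ (m ↦ g (k m + d))` over the digits of `n` and evaluating at `0` evaluates `g` at `n`.
[cite: AlloucheShallit2003, Thm. 6.6.2 (proof)] -/
theorem foldl_kernelStep_apply_zero {k : ℕ} (hk : 2 ≤ k) {K : Set (ℕ → ℂ)}
    (ρ : ℕ → K → K) (hρ : ∀ d, d < k → ∀ g : K, ((ρ d g : K) : ℕ → ℂ) = fun m => (g : ℕ → ℂ) (k * m + d))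
    (n : ℕ) (g : K) :
    (((Nat.digits k n).foldl (fun g d => ρ d g) g : K) : ℕ → ℂ) 0 = (g : ℕ → ℂ) n := by
  induction n using Nat.strong_induction_on generalizing g with
  | _ n ih =>
    rcases Nat.eq_zero_or_pos n with rfl | hn
    · simp
    · rw [Nat.digits_def' hk hn, List.foldl_cons, ih (n / k) (Nat.div_lt_self hn hk) (ρ (n % k) g),
        hρ _ (Nat.mod_lt n (by omega)) g]
      simp only [Nat.div_add_mod]

/-- Reading most significant digit first with "compose on the right" recovers the least
significant digit first action. [folklore] -/
theorem foldl_comp_apply {K : Type*} (ρ : ℕ → K → K) (M : List ℕ) (Φ : K → K) (g : K) :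
    (M.foldl (fun Φ d => Φ ∘ ρ d) Φ) g = Φ (M.reverse.foldl (fun g d => ρ d g) g) := by
  induction M generalizing Φ with
  | nil => simp
  | cons x M ih => simp [List.foldl_cons, ih, List.foldl_append]

/-- **Finite kernel ⇒ automatic (MSB-first DFAO)** (Allouche–Shallit, Thm. 6.6.2, "⇐", composed
with the reversal of the reading direction): if the `k`-kernel of `a` is finite (`k ≥ 2`) then
`a = dfaoSeq k δ q₀ τ` for a DFAO with finitely many states — states: self-maps of
`{a} ∪ K_k(a)`, transitions `Φ ↦ Φ ∘ ρ_d` with `ρ_d(g)(m) = g(km + d)`, output `Φ ↦ Φ(a)(0)`.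
[cite: AlloucheShallit2003, Thm. 6.6.2] -/
theorem IsAutomaticSeq.exists_dfaoSeq {k : ℕ} (hk : 2 ≤ k) {a : ℕ → ℂ} (h : IsAutomaticSeq k a) :
    ∃ (σ : Type) (_ : Fintype σ) (δ : σ → ℕ → σ) (q₀ : σ) (τ : σ → ℂ), a = dfaoSeq k δ q₀ τ := by
  classical
  set K : Set (ℕ → ℂ) := insert a (qKernel k a) with hK
  have hKfin : K.Finite := h.insert a
  haveI : Finite K := hKfin.to_subtype
  -- the kernel maps `ρ_d : g ↦ (m ↦ g (k m + d))` preserve `K` for digits `d < k`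
  have hclosed : ∀ d, d < k → ∀ g ∈ K, (fun m => g (k * m + d)) ∈ K := by
    intro d hd g hg
    rcases hg with rfl | ⟨i, hi, r, hr, rfl⟩
    · refine Or.inr ⟨1, le_rfl, d, by simpa using hd, ?_⟩
      simp
    · refine Or.inr ⟨i + 1, by omega, k ^ i * d + r, ?_, ?_⟩
      · calc k ^ i * d + r < k ^ i * d + k ^ i := by omega
          _ = k ^ i * (d + 1) := by ring
          _ ≤ k ^ i * k := Nat.mul_le_mul_left _ hd
          _ = k ^ (i + 1) := (pow_succ k i).symm
      · funext m
        simp only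
        congr 1
        ring
  let ρ : ℕ → K → K := fun d g =>
    if hd : d < k then ⟨fun m => (g : ℕ → ℂ) (k * m + d), hclosed d hd g g.2⟩ else g
  have hρ : ∀ d, d < k → ∀ g : K, ((ρ d g : K) : ℕ → ℂ) = fun m => (g : ℕ → ℂ) (k * m + d) := by
    intro d hd g
    simp only [ρ, dif_pos hd]
  haveI : Fintype (K → K) := Fintype.ofFinite _
  let g₀ : K := ⟨a, Set.mem_insert a _⟩
  refine ⟨K → K, inferInstance, fun Φ d => Φ ∘ ρ d, id, fun Φ => ((Φ g₀ : K) : ℕ → ℂ) 0, ?_⟩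
  funext n
  simp only [dfaoSeq, foldl_comp_apply, List.reverse_reverse, id]
  exact (foldl_kernelStep_apply_zero hk ρ hρ n g₀).symm

/-- **Automatic (MSB-first DFAO) ⇒ finite kernel** (Allouche–Shallit, Thm. 6.6.2, "⇒"): the
sequence generated by a DFAO with finitely many states has finite `k`-kernel (`k ≥ 2`): the kernel
element `(a(k^i n + r))_n` is determined by the state map `q ↦ δ(q, (r)_k^i)` and the value `a(r)`.
[cite: AlloucheShallit2003, Thm. 6.6.2] -/
theorem isAutomaticSeq_dfaoSeq [Finite σ] {k : ℕ} (hk : 2 ≤ k) (δ : σ → ℕ → σ) (q₀ : σ)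
    (τ : σ → ℂ) : IsAutomaticSeq k (dfaoSeq k δ q₀ τ) := by
  classical
  have hk1 : 1 < k := hk
  -- parametrisation of the kernel by (state map, value at 0)
  let st : ℕ → σ := fun n => (Nat.digits k n).reverse.foldl δ q₀
  let F : (σ → σ) × ℂ → (ℕ → ℂ) := fun p n => if n = 0 then p.2 else τ (p.1 (st n))
  have hfin : (F '' (Set.univ ×ˢ Set.range τ)).Finite :=
    ((Set.finite_univ).prod (Set.finite_range τ)).image F
  refine hfin.subset ?_
  rintro g ⟨i, -, r, hr, rfl⟩
  refine ⟨(fun q => (msbBlock k i r).foldl δ q, dfaoSeq k δ q₀ τ r), ⟨Set.mem_univ _, ⟨_, rfl⟩⟩, ?_⟩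
  funext n
  simp only [F]
  split_ifs with hn
  · simp [hn]
  · rw [dfaoSeq, add_comm, foldl_digits_add_pow_mul hk1 hr (Nat.pos_of_ne_zero hn)]

/-- **Allouche–Shallit, Thm. 6.6.2, in the tree's vocabulary**: for `k ≥ 2`, `a : ℕ → ℂ` has finite
`k`-kernel (`IsAutomaticSeq k a`) iff it is generated by a deterministic finite automaton with
output reading the base-`k` digits from the most significant one. [cite: AlloucheShallit2003, Thm. 6.6.2] -/
theorem isAutomaticSeq_iff_exists_dfaoSeq {k : ℕ} (hk : 2 ≤ k) (a : ℕ → ℂ) :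
    IsAutomaticSeq k a ↔
      ∃ (σ : Type) (_ : Fintype σ) (δ : σ → ℕ → σ) (q₀ : σ) (τ : σ → ℂ), a = dfaoSeq k δ q₀ τ := by
  refine ⟨fun h => h.exists_dfaoSeq hk, ?_⟩
  rintro ⟨σ, _, δ, q₀, τ, rfl⟩
  exact isAutomaticSeq_dfaoSeq hk δ q₀ τ

end Bridge

end Literature.NumberTheory.LFunctions
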